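import Literature.AlgebraicGeometry.Motives.EllAdicTowerRational
import Literature.AlgebraicGeometry.Motives.EllAdicEtaleFunctor
import HarnessLib

/-!
# `X ↦ Hⁱ((X_{k̄})_ét, ℚ_ℓ)` as a functor `(Sch/k)ᵒᵖ ⥤ Mod_{ℚ_ℓ}`

Packaging of `EllAdicTowerRational.lean` in the shape of the first field
`H : ℕ → (SchemeOver k)ᵒᵖ ⥤ ModuleCat K` of the tree's `PreWeilCohomology` (Kleiman 1968 §1.2):

* (functoriality of `X ↦ X_{k̄}`, `geometricFibreHom_id/_comp`, is the tree's `EllAdicEtaleFunctor.lean`);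
* `ellAdicCohomologyFunctor k ℓ i : (SchemeOver k)ᵒᵖ ⥤ ModuleCat ℚ_ℓ`, `X ↦ ℚ_ℓ ⊗ lim_m Hⁱ((X_{k̄})_ét, ℤ/ℓᵐ)`,
  `φ ↦ (φ × 1)^*` (Deligne, Weil I (1.1)–(1.3): "`Hⁱ(X̄, ℚ_ℓ)`, contravariant in `X`"), whose
  values carry the cup products, units and Galois representations of `EllAdicTowerRational.lean`
  (`ellAdicCohomologyFunctor_map_cup`, `_map_one`, `_map_ρ`).

The remaining fields of a `PreWeilCohomology` (trace map, cycle class map) and all axioms of a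
(Galois) Weil cohomology theory are the deep part of SGA 4/4½ and are not constructed here.

## References

* P. Deligne, *La conjecture de Weil. I*, Publ. Math. IHÉS 43 (1974), (1.1)–(1.3), (1.15). [Deligne1974]
* S. Kleiman, *Algebraic cycles and the Weil conjectures* (1968), §1.2. [Kleiman1968]
-/

universe u

open CategoryTheory CategoryTheory.Limits AlgebraicGeometry Opposite
open scoped TensorProduct

namespace Literature.AlgebraicGeometry.Motives

set_option synthInstance.maxHeartbeats 400000
set_option maxHeartbeats 1600000

/-! ### The functor `Hⁱ((–)_{k̄}, ℚ_ℓ)` -/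

section Functor

variable (k : Type u) [Field k] (ℓ : ℕ) [Fact ℓ.Prime] (i : ℕ)

/-- **`Hⁱ((–)_{k̄}, ℚ_ℓ) : (Sch/k)ᵒᵖ ⥤ Mod_{ℚ_ℓ}`**, `X ↦ ℚ_ℓ ⊗_{ℤ_ℓ} lim_m Hⁱ((X_{k̄})_ét, ℤ/ℓᵐ)`,
`φ ↦ (φ × 1)^*` — the shape of the field `PreWeilCohomology.H` (Kleiman §1.2; Deligne, Weil I
(1.1)–(1.3)). [cite: Deligne1974, (1.1)–(1.3)] -/
noncomputable def ellAdicCohomologyFunctor : (SchemeOver k)ᵒᵖ ⥤ ModuleCat.{u} ℚ_[ℓ] where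
  obj X := ModuleCat.of ℚ_[ℓ] (etaleEllAdicRat ℓ (geometricFibre k X.unop) i)
  map φ := ModuleCat.ofHom (etaleEllAdicRatMap (geometricFibreHom φ.unop) ℓ i)
  map_id X := by
    rw [unop_id, geometricFibreHom_id, etaleEllAdicRatMap_id]
    rfl
  map_comp φ ψ := by
    rw [unop_comp, geometricFibreHom_comp, etaleEllAdicRatMap_comp]
    rfl

variable {k ℓ i}

/-- The values of the functor are the `ℚ_ℓ`-cohomology groups of the geometric fibres (by `rfl`).
[folklore] -/
theorem ellAdicCohomologyFunctor_obj (X : SchemeOver k) :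
    (ellAdicCohomologyFunctor k ℓ i).obj (op X) =
      ModuleCat.of ℚ_[ℓ] (etaleEllAdicRat ℓ (geometricFibre k X) i) :=
  rfl

/-- The functor acts on morphisms by `(φ × 1)^*` (by `rfl`). [folklore] -/
theorem ellAdicCohomologyFunctor_map_apply {X X' : SchemeOver k} (φ : X ⟶ X')
    (y : etaleEllAdicRat ℓ (geometricFibre k X') i) :
    ((ellAdicCohomologyFunctor k ℓ i).map φ.op).hom y =
      etaleEllAdicRatMap (geometricFibreHom φ) ℓ i y :=
  rfl

/-- **Pull-backs of the functor are multiplicative** for the cup products of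
`EllAdicTowerRational.lean` (the shape of the Weil-cohomology axiom `map_cup`). [folklore] -/
theorem ellAdicCohomologyFunctor_map_cup {X X' : SchemeOver k} (φ : X ⟶ X') {a b n : ℕ}
    (h : a + b = n) (x : etaleEllAdicRat ℓ (geometricFibre k X') a)
    (y : etaleEllAdicRat ℓ (geometricFibre k X') b) :
    ((ellAdicCohomologyFunctor k ℓ n).map φ.op).hom (etaleEllAdicRat.cup ℓ _ h x y) =
      etaleEllAdicRat.cup ℓ _ h (((ellAdicCohomologyFunctor k ℓ a).map φ.op).hom x)
        (((ellAdicCohomologyFunctor k ℓ b).map φ.op).hom y) :=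
  etaleEllAdicRat.map_cup ℓ _ h x y

/-- **Pull-backs of the functor are unital** (the shape of the axiom `map_one`). [folklore] -/
theorem ellAdicCohomologyFunctor_map_one {X X' : SchemeOver k} (φ : X ⟶ X') :
    ((ellAdicCohomologyFunctor k ℓ 0).map φ.op).hom (etaleEllAdicRat.one ℓ (geometricFibre k X')) =
      etaleEllAdicRat.one ℓ (geometricFibre k X) :=
  etaleEllAdicRat.map_one ℓ _

/-- **Pull-backs of the functor are Galois equivariant** (the shape of
`GaloisWeilCohomology.pullback_ρ`). [folklore] -/
theorem ellAdicCohomologyFunctor_map_ρ {X X' : SchemeOver k} (φ : X ⟶ X')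
    (g : Field.absoluteGaloisGroup k) (y : etaleEllAdicRat ℓ (geometricFibre k X') i) :
    ((ellAdicCohomologyFunctor k ℓ i).map φ.op).hom (geometricEllAdicRatRep X' ℓ i g y) =
      geometricEllAdicRatRep X ℓ i g (((ellAdicCohomologyFunctor k ℓ i).map φ.op).hom y) :=
  (LinearMap.congr_fun (geometricEllAdicRatRep_pullback ℓ i φ g) y).symm

end Functor

end Literature.AlgebraicGeometry.Motives
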